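import Summits.AtomisticToContinuum.Crystallization.Theorems.ChargedEnergyGapShellCascade
import HarnessLib

/-!
# ChargedEnergyGap · NODE 72 «QuantisedSeams», part A (lens-3 g72): the Burgers-lattice binder, LOCAL EXACTNESS (PROVED), the re-typed pieces

Line of record `stmt-AtomisticToContinuum-14231` (`PricedLinkCensus.ChargedEnergyGap`); residual of record after NODE 71 «ShellCascade» = the
SIXTEEN-leaf designate `chargedEnergyGap_of_shellCascade_designate(NN)`.  THIS NODE IS A REPAIR OF THE HYPOTHESIS BLOCK shared by every transfer
piece of the cascade ([LOAD-ᶜ], [COER-ᶜ], [BAR♮-ᶜ], [GEO♮-ᶜ], [STIFF-ᶜ], [MID-ᶜ], [FAR-ᶜ], (H𝄪ᶜ) = (H𝄪ᶠ)/(H𝄪ʰ)/(H𝄪ᴮ), (H𝄪ˢ)).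

FINDING (memo g72 §1, numerics `num/tile_load.py`, floats) — **THE FLOOR IS DEFEATED BY SUPERPOSITION.**  `IsSeamSystem b₀ r_S P S` floors the
Burgers vector of each PIECE (`b = 0 ∨ b₀ ≤ ‖b‖`) but admits COMPOSITE SEAMS: a complete lattice plane family `Π + Λ_P` tiled (per period, by a
generic irrational grid — no reference bond meets a tile edge) by floored pieces with Burgers vectors `b + ε_T` (`‖b‖ ≥ b₀`, `ε_T` small and
free), together with the global cocycle `β₀ := −b·δN` (`N` = number of planes of the family below the site), gives the Volterra field
`β = Σ_T ε_T·[the bond crosses Π inside T]` — an arbitrary pattern of UNFLOORED jumps, admissible with NO excision at all (`X = ∅`: `SmallStrain 3/100`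
holds as soon as `‖ε_T‖ ≤ 0.028`), hence unpriced.  Its load on one tile in the plateau (`χw = 1`) is `loadL = ⟪ε, Φ_T⟫`, `Φ_T := Σ_{bonds crossing T}
V′(d)·ê`: zero for an exact period tile (stress-freeness; `1e-12` in floats) but `‖Φ_T‖ ≈ 1 – 3.8` for generic `8.5 × 8.5`-bond tiles (lattice-row
discrepancy, robust under offsets), while every quadratic form of the tile is `O(‖ε‖²)` (`t·springL ≈ 138‖ε‖²`, `λ·stiffL ≈ 362‖ε‖²`): choosing
`ε ∥ −Φ_T`, `‖ε‖ ≈ 0.005 – 0.013`, the model energy is `−0.009 … −0.023` PER TILE against fixed currencies, and `n` sparse tiles drive it to `−∞`.  So, AS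
TYPED, [LOAD-ᶜ] (`c = f, h`) and every transfer bound with a linear term over the `IsSeamSystem` block ((H𝄪ᶜ), (H𝄪ᶠ), (H𝄪ʰ), (H𝄪ᴮ), (H𝄪ˢ)) are FALSE
(memo-level refutation: the mechanism of memo g55 §1 A5(i) — unfloored rim discs — re-entering through piece superposition); and the quadratic pieces
[MID-ᶜ]/[FAR-ᶜ]/[GEO♮-ᶜ]/[BAR♮-ᶜ]/[COER-ᶜ] face WEAK JUNCTION LINES (adjacent tiles, `Δb` arbitrarily small): unexcised, unpriced lines on which `β` is
NOT a local coboundary, so no cluster / Bloch certificate applies to them as typed (their truth is left undecided).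

REPAIR — THE ONE NEW BINDER `IsQuantisedSeams b₁ S`: the Burgers vectors of all pieces lie in ONE additive subgroup of `E3` floored at `b₁`
(`∀ t ∈ L, t = 0 ∨ b₁ ≤ ‖t‖`).  Physically automatic and exactly what the floor was meant to encode: the seams of ONE reference grain carry Burgers
vectors that are differences of Barlow positions of that grain — lattice vectors, Shockley partials, their sums — a discrete group whose shortest
non-zero element is the stair-rod `d₁/3 ≈ 0.3237` (fcc; hcp: the basal Shockley `≈ 0.56`); designate `b₁ = 3/10`.  CONSEQUENCE (§Q1, PROVED): every
cut jump and every loop holonomy of the Volterra field lies in `L`; a non-excised triangle of perimeter `< b₁/τ` has ZERO holonomy; so ON EVERY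
NON-EXCISED CLUSTER OF DIAMETER `< b₁/(3τ) = 10/3` THE VOLTERRA FIELD IS A COBOUNDARY (`volterraField_localExact`: octahedra `1.37`, cuboctahedral
stars `1.94`, third shells `1.68` …) — the structural input the octahedron certificate of [MID] and the cluster certificates of [FAR] need, and false
without the binder.  Composite tiles now differ by `0` or `≥ b₁ > τ·10`, so every junction line forces an excised collar (priced by `c_H`).

THE RE-TYPED PIECES (§Q2): [LOAD-q], [COER-q], (H-q), [BAR♮-q], [GEO♮-q], [STIFF-q], [MID-q], [FAR-q] = the record pieces VERBATIM with
`IsQuantisedSeams b₁ S →` inserted after `IsSeamSystem b₀ r_S P S →` (dial `b₁` after `r_S`).  Each is IMPLIED by its record piece (§Q3, PROVED —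
nothing proved or instrumented so far is lost: every census instance had constant Burgers vectors, `isQuantisedSeams_of_const`), hence WEAKER; the
record pieces with a load term being false as typed, the q-pieces are the line's pieces from now on.  Part B: the glue re-threaded (PROVED), the
re-typed reduction leaf (N-q) (STRONGER than (N𝄪ᶠʰ), WEAKER than the budget leaf, PROVED both), the SIXTEEN-LEAF q-DESIGNATE cone (PROVED).

0 sorry · 0 native_decide · no private / instance / notation · standard axioms · ≤ 400 lines per part.
-/

noncomputable section
open scoped Classical
open Literature.MathematicalPhysics.StatisticalMechanics Literature.Geometry.DiscreteGeometry
open Summit.AtomisticToContinuum.Crystallization.Theses.PricedLinkCensus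
open Summit.AtomisticToContinuum.Crystallization.Theorems.ChargedEnergyGapNegative

namespace Summit.AtomisticToContinuum.Crystallization.Theorems.ChargedEnergyGapChartDial

/-! ## §Q1 The Burgers-lattice binder and LOCAL EXACTNESS of the Volterra field (PROVED) -/

section Quantised

variable (b₁ : ℝ) {k : ℕ} (S : Fin k → CutPiece)

/-- **QUANTISED SEAMS** of floor `b₁`: the Burgers vectors of all pieces lie in one additive subgroup of `E3` whose non-zero elements have norm
`≥ b₁` — equivalently, every `ℤ`-combination of the pieces' Burgers vectors is `0` or has norm `≥ b₁`.  (The group is the Burgers lattice of the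
reference grain; the binder is independent of the reference `P`.) -/
def IsQuantisedSeams : Prop :=
  ∃ L : AddSubgroup E3, (∀ t ∈ L, t = 0 ∨ b₁ ≤ ‖t‖) ∧ ∀ i, (S i).burgers ∈ L

variable {b₁ S}

/-- Degenerate instance: the EMPTY system is quantised at every floor (the trivial group). -/
theorem isQuantisedSeams_fin_zero (b₁ : ℝ) (S : Fin 0 → CutPiece) : IsQuantisedSeams b₁ S :=
  ⟨⊥, fun _ ht => Or.inl ((AddSubgroup.mem_bot).1 ht), fun i => i.elim0⟩

/-- Quantisation is antitone in the floor. -/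
theorem IsQuantisedSeams.anti {b₁' : ℝ} (hb : b₁ ≤ b₁') (h : IsQuantisedSeams b₁' S) : IsQuantisedSeams b₁ S := by
  obtain ⟨L, hL, hS⟩ := h
  exact ⟨L, fun t ht => (hL t ht).imp id fun h => hb.trans h, hS⟩

/-- SANITY (every instrumented seam system is admitted): a system all of whose pieces carry the SAME Burgers vector `b` with `b = 0 ∨ b₁ ≤ ‖b‖`
(one stacking seam and its lattice translates, a twin stack of one partial, a perfect-dislocation cut) is quantised — `L = ℤ·b`. -/
theorem isQuantisedSeams_of_const {b : E3} (hb : b = 0 ∨ b₁ ≤ ‖b‖) (hS : ∀ i, (S i).burgers = b) : IsQuantisedSeams b₁ S := by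
  refine ⟨AddSubgroup.zmultiples b, fun _ ht => ?_, fun i => (hS i) ▸ AddSubgroup.mem_zmultiples b⟩
  obtain ⟨n, rfl⟩ := AddSubgroup.mem_zmultiples_iff.1 ht
  rcases hb with hb | hb
  · exact Or.inl (by simp [hb])
  · by_cases hn : n = 0
    · exact Or.inl (by simp [hn])
    · refine Or.inr ?_
      rw [← Int.cast_smul_eq_zsmul ℝ, norm_smul]
      have h1 : (1 : ℝ) ≤ ‖(n : ℝ)‖ := by
        rw [Real.norm_eq_abs, ← Int.cast_abs]
        exact_mod_cast Int.one_le_abs hn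
      nlinarith [norm_nonneg b]

/-- The jump of a piece whose Burgers vector lies in `L` lies in `L` (it is `b`, `−b` or `0`) … -/
theorem CutPiece.jump_mem_of_burgers_mem {F : CutPiece} {L : AddSubgroup E3} (h : F.burgers ∈ L) (y z : E3) : F.jump y z ∈ L := by
  unfold CutPiece.jump
  split_ifs
  exacts [h, L.neg_mem h, L.zero_mem]

/-- … hence so does the CUT JUMP of a quantised system on every bond (a finite sum of finite sums of such jumps). -/
theorem cutJump_mem {P : PeriodicConfiguration 3} {L : AddSubgroup E3} (h : ∀ i, (S i).burgers ∈ L) (y z : E3) : cutJump P S y z ∈ L := by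
  unfold cutJump
  refine sum_mem fun i _ => ?_
  exact finsum_induction (fun v => v ∈ L) L.zero_mem (fun _ _ ha hb => L.add_mem ha hb)
    fun g => CutPiece.jump_mem_of_burgers_mem (F := (S i).shift (g : E3)) (h i) y z

variable {τ : ℝ} {P : PeriodicConfiguration 3} {X : Set E3} {β₀ : E3 → E3 → E3}

/-- ★ **SHORT LOOPS HAVE NO HOLONOMY** (PROVED): for a global cocycle `β₀`, a quantised system of floor `b₁` and a Volterra field of strain `≤ τ` off
`X`, every triangle of NON-excised sites with `τ·(perimeter) < b₁` is closed: `β y z + β z x = β y x`.  (The holonomy is a cut-jump combination, so it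
lies in `L`; its norm is at most `τ·perimeter < b₁`; the floor dichotomy makes it `0`.)  FALSE without the binder: two adjacent floored pieces with
Burgers vectors `b`, `b + ε` leave holonomy `±ε` around their junction line. -/
theorem volterraField_triangle (hβ : IsGlobalCocycle P β₀) (hq : IsQuantisedSeams b₁ S) (hτ : SmallStrain τ P X (volterraField P S β₀))
    {y z x : E3} (hy : y ∈ P.points) (hz : z ∈ P.points) (hx : x ∈ P.points) (hyX : y ∉ X) (hzX : z ∉ X) (hxX : x ∉ X)
    (hper : τ * (dist y z + dist z x + dist y x) < b₁) :
    volterraField P S β₀ y z + volterraField P S β₀ z x = volterraField P S β₀ y x := by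
  obtain ⟨L, hL, hS⟩ := hq
  have key : volterraField P S β₀ y z + volterraField P S β₀ z x - volterraField P S β₀ y x =
      cutJump P S y z + cutJump P S z x - cutJump P S y x := by
    simp only [volterraField]
    rw [← hβ.2.2 y hy z hz x hx]
    abel
  have hmem : cutJump P S y z + cutJump P S z x - cutJump P S y x ∈ L :=
    L.sub_mem (L.add_mem (cutJump_mem hS y z) (cutJump_mem hS z x)) (cutJump_mem hS y x)
  rcases hL _ hmem with h0 | hge
  · exact sub_eq_zero.1 (key.trans h0)
  · exfalso
    have h1 := hτ y hy z hz hyX hzX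
    have h2 := hτ z hz x hx hzX hxX
    have h3 := hτ y hy x hx hyX hxX
    have hn : ‖cutJump P S y z + cutJump P S z x - cutJump P S y x‖ ≤ τ * (dist y z + dist z x + dist y x) := by
      rw [← key]
      calc ‖volterraField P S β₀ y z + volterraField P S β₀ z x - volterraField P S β₀ y x‖
          ≤ ‖volterraField P S β₀ y z + volterraField P S β₀ z x‖ + ‖volterraField P S β₀ y x‖ := norm_sub_le _ _
        _ ≤ ‖volterraField P S β₀ y z‖ + ‖volterraField P S β₀ z x‖ + ‖volterraField P S β₀ y x‖ := by
          gcongr; exact norm_add_le _ _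
        _ ≤ τ * (dist y z + dist z x + dist y x) := by linarith
    linarith

/-- ★★ **LOCAL EXACTNESS** (PROVED): on every set `K` of non-excised sites all of whose triangles have `τ·perimeter < b₁`, the Volterra field of a
quantised system IS A COBOUNDARY — `β y z = u z − u y` on `K` (`u z := β y₀ z` for any base point `y₀ ∈ K`).  This is the input every cluster
certificate needs (octahedra for [MID-q], third-shell clusters for [FAR-q]); it is what weak junction lines destroy in the unquantised block. -/
theorem volterraField_localExact (hβ : IsGlobalCocycle P β₀) (hq : IsQuantisedSeams b₁ S) (hτ : SmallStrain τ P X (volterraField P S β₀))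
    {K : Set E3} (hKP : K ⊆ P.points) (hKX : ∀ y ∈ K, y ∉ X)
    (hK : ∀ y ∈ K, ∀ z ∈ K, ∀ x ∈ K, τ * (dist y z + dist z x + dist y x) < b₁) :
    ∃ u : E3 → E3, ∀ y ∈ K, ∀ z ∈ K, volterraField P S β₀ y z = u z - u y := by
  by_cases hne : K.Nonempty
  · obtain ⟨y₀, hy₀⟩ := hne
    refine ⟨fun z => volterraField P S β₀ y₀ z, fun y hy z hz => ?_⟩
    have h := volterraField_triangle hβ hq hτ (hKP hy₀) (hKP hy) (hKP hz) (hKX _ hy₀) (hKX _ hy) (hKX _ hz) (hK _ hy₀ _ hy _ hz)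
    exact eq_sub_of_add_eq' h
  · exact ⟨0, fun y hy => (hne ⟨y, hy⟩).elim⟩

/-- LOCAL EXACTNESS BY DIAMETER: the same on every set of non-excised sites of diameter `≤ δ` with `3τδ < b₁` (at the designate `τ = 3/100`,
`b₁ = 3/10`: every cluster of diameter `< 10/3` — octahedra, cuboctahedral stars, third and fourth shells of the stress-free cells). -/
theorem volterraField_localExact_of_diam (hβ : IsGlobalCocycle P β₀) (hq : IsQuantisedSeams b₁ S)
    (hτ : SmallStrain τ P X (volterraField P S β₀)) (hτ0 : 0 ≤ τ) {δ : ℝ} (hδ : 3 * τ * δ < b₁)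
    {K : Set E3} (hKP : K ⊆ P.points) (hKX : ∀ y ∈ K, y ∉ X) (hK : ∀ y ∈ K, ∀ z ∈ K, dist y z ≤ δ) :
    ∃ u : E3 → E3, ∀ y ∈ K, ∀ z ∈ K, volterraField P S β₀ y z = u z - u y := by
  refine volterraField_localExact hβ hq hτ hKP hKX fun y hy z hz x hx => lt_of_le_of_lt ?_ hδ
  have h1 := hK y hy z hz
  have h2 := hK z hz x hx
  have h3 := hK y hy x hx
  nlinarith

/-- The designate range of local exactness: `3·(3/100)·δ < 3/10 ⟺ δ < 10/3`. -/
theorem localExact_designate_range (δ : ℝ) : 3 * (3 / 100 : ℝ) * δ < 3 / 10 ↔ δ < 10 / 3 := by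
  constructor <;> intro h <;> linarith

end Quantised

/-! ## §Q2 The re-typed pieces over the quantised block -/

section Pieces

variable (cls : Set E3 → Prop) (s lam ℓ μ₀ τ lamQ ϱ b₀ r_S b₁ ϱχ r₁ r₂ : ℝ)

/-- (H-q)(`C_T, Cχ`) · **THE LOCALISED SEAM TRANSFER BOUND OVER THE QUANTISED BLOCK**: (H𝄪ᶜ) VERBATIM with the binder `IsQuantisedSeams b₁ S`
inserted after the seam-system binder · WEAKER than (H𝄪ᶜ) (`LocalSeamTransferBoundCls.quantised`) · UNDECIDED → TRUE-leaning at the designate ·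
INSTRUMENTABLE · ATTACKABLE-M (target of the q-cascade below).  Why it might fail: as (H𝄪ᶜ) minus the composite-seam family (now excluded: tiles differ
by `0` or `≥ b₁`, junction lines are collared and priced) — an excised-collar geometry beating `(C_T, Cχ)`. -/
def LocalSeamTransferBoundQ (C_T Cχ : ℝ) : Prop :=
  ∃ C_H : ℝ, 0 ≤ C_H ∧ ∀ (P : PeriodicConfiguration 3) (C X : Set E3) (β₀ : E3 → E3 → E3) (k : ℕ) (S : Fin k → CutPiece)
    (m : ℕ) (D : Fin m → Set E3) (σ : Fin m → Bool),
    IsSeparatedRef s P → IsLabelledRef lam ℓ P → cls P.points → IsForceFree P → IsSiteStressFree P → HarmStableModRot μ₀ P →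
    IsInvariantSet P C → IsInvariantSet P X → IsGlobalCocycle P β₀ → IsSeamSystem b₀ r_S P S → IsQuantisedSeams b₁ S →
    SmallStrain τ P X (volterraField P S β₀) → (∀ i, IsInvariantSet P (D i)) →
      -(C_T * shellMassL ϱχ D σ P X ϱ C) - Cχ * transMassL ϱχ D σ P X ϱ C - C_H * (pricedNearCountL ϱχ D σ P X ϱ C : ℝ) ≤
        modelFarL ϱχ D σ (volterraField P S β₀) P X lamQ ϱ C

/-- ★ piece [LOAD-q](`t, A_T, Aχ`) · **CONSISTENCY OVER THE QUANTISED BLOCK**: [LOAD-ᶜ] VERBATIM with the binder `IsQuantisedSeams b₁ S` ·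
WEAKER than [LOAD-ᶜ] — which is FALSE AS TYPED (the composite ε-tile family, module docstring) · UNDECIDED → TRUE-leaning at the designate ·
INSTRUMENTABLE · ATTACKABLE-M.  Why it might fail: the `springL`-dual norm of the ghost-force load exceeding `4t·A_T` per shell site (census margin
`≈ 2.1` of C11-29); a priced junction / rim geometry whose linear gain per collar site exceeds every `A_H` (none known: gain `≲ 0.4` per unit line,
`≈ 11` collar sites per unit line). -/
def LoadBoundQ (t A_T Aχ : ℝ) : Prop :=
  ∃ A_H : ℝ, 0 ≤ A_H ∧ ∀ (P : PeriodicConfiguration 3) (C X : Set E3) (β₀ : E3 → E3 → E3) (k : ℕ) (S : Fin k → CutPiece)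
    (m : ℕ) (D : Fin m → Set E3) (σ : Fin m → Bool),
    IsSeparatedRef s P → IsLabelledRef lam ℓ P → cls P.points → IsForceFree P → IsSiteStressFree P → HarmStableModRot μ₀ P →
    IsInvariantSet P C → IsInvariantSet P X → IsGlobalCocycle P β₀ → IsSeamSystem b₀ r_S P S → IsQuantisedSeams b₁ S →
    SmallStrain τ P X (volterraField P S β₀) → (∀ i, IsInvariantSet P (D i)) →
      -(A_T * shellMassL ϱχ D σ P X ϱ C) - Aχ * transMassL ϱχ D σ P X ϱ C - A_H * (pricedNearCountL ϱχ D σ P X ϱ C : ℝ) ≤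
        loadL ϱχ D σ (volterraField P S β₀) P X ϱ C + t * springL ϱχ D σ (volterraField P S β₀) P X r₁ ϱ C

/-- ★ piece [COER-q](`μ, c_T, cχ`) · [COER-ᶜ] VERBATIM over the quantised block · WEAKER than [COER-ᶜ] · UNDECIDED → TRUE-leaning · glued below from
[BAR♮-q] ∧ [GEO♮-q].  Why it might fail: as [COER-ᶜ] (a small-strain field concentrating on the destabilising bonds where `χ·w` varies fastest). -/
def CoerciveStiffQ (μ c_T cχ : ℝ) : Prop :=
  ∃ c_H : ℝ, 0 ≤ c_H ∧ ∀ (P : PeriodicConfiguration 3) (C X : Set E3) (β₀ : E3 → E3 → E3) (k : ℕ) (S : Fin k → CutPiece)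
    (m : ℕ) (D : Fin m → Set E3) (σ : Fin m → Bool),
    IsSeparatedRef s P → IsLabelledRef lam ℓ P → cls P.points → IsForceFree P → IsSiteStressFree P → HarmStableModRot μ₀ P →
    IsInvariantSet P C → IsInvariantSet P X → IsGlobalCocycle P β₀ → IsSeamSystem b₀ r_S P S → IsQuantisedSeams b₁ S →
    SmallStrain τ P X (volterraField P S β₀) → (∀ i, IsInvariantSet P (D i)) →
      μ * springL ϱχ D σ (volterraField P S β₀) P X r₁ ϱ C - c_T * shellMassL ϱχ D σ P X ϱ C - cχ * transMassL ϱχ D σ P X ϱ C -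
          c_H * (pricedNearCountL ϱχ D σ P X ϱ C : ℝ) ≤
        stiffL ϱχ D σ (volterraField P S β₀) P X ϱ C

/-- ★ piece [BAR♮-q](`μ₁, η, c_T, cχ`) · [BAR♮-ᶜ] VERBATIM over the quantised block · WEAKER than [BAR♮-ᶜ] · UNDECIDED → TRUE-leaning · glued below
from [STIFF-q] ∧ [MID-q] ∧ [FAR-q].  Why it might fail: as [BAR♮-ᶜ] (short-wave slack `≈ 0.10 | 0.053` must pay `η·N` at weight edges). -/
def BarExchQ (μ₁ η c_T cχ : ℝ) : Prop :=
  ∃ c_H : ℝ, 0 ≤ c_H ∧ ∀ (P : PeriodicConfiguration 3) (C X : Set E3) (β₀ : E3 → E3 → E3) (k : ℕ) (S : Fin k → CutPiece)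
    (m : ℕ) (D : Fin m → Set E3) (σ : Fin m → Bool),
    IsSeparatedRef s P → IsLabelledRef lam ℓ P → cls P.points → IsForceFree P → IsSiteStressFree P → HarmStableModRot μ₀ P →
    IsInvariantSet P C → IsInvariantSet P X → IsGlobalCocycle P β₀ → IsSeamSystem b₀ r_S P S → IsQuantisedSeams b₁ S →
    SmallStrain τ P X (volterraField P S β₀) → (∀ i, IsInvariantSet P (D i)) →
      μ₁ * springL ϱχ D σ (volterraField P S β₀) P X r₁ ϱ C + η * nonAffL ϱχ D σ (volterraField P S β₀) P X r₁ ϱ C -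
            c_T * shellMassL ϱχ D σ P X ϱ C - cχ * transMassL ϱχ D σ P X ϱ C -
          c_H * (pricedNearCountL ϱχ D σ P X ϱ C : ℝ) ≤
        barL ϱχ D σ (volterraField P S β₀) P X ϱ C

/-- ★ piece [GEO♮-q](`ν₀, η, c_T, cχ`) · [GEO♮-ᶜ] VERBATIM over the quantised block · WEAKER than [GEO♮-ᶜ] · UNDECIDED → TRUE-leaning · a LEAF of the
q-designate.  Why it might fail: as [GEO♮-ᶜ] (zone-boundary fields, `max_k(−G − ν₀λ_min S)/N ≈ 0.016 | 0.010` vs `η = 1/25 | 1/40`, excised stars);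
the weak-junction objection is gone (local exactness). -/
def GeoExchQ (ν₀ η c_T cχ : ℝ) : Prop :=
  ∃ c_H : ℝ, 0 ≤ c_H ∧ ∀ (P : PeriodicConfiguration 3) (C X : Set E3) (β₀ : E3 → E3 → E3) (k : ℕ) (S : Fin k → CutPiece)
    (m : ℕ) (D : Fin m → Set E3) (σ : Fin m → Bool),
    IsSeparatedRef s P → IsLabelledRef lam ℓ P → cls P.points → IsForceFree P → IsSiteStressFree P → HarmStableModRot μ₀ P →
    IsInvariantSet P C → IsInvariantSet P X → IsGlobalCocycle P β₀ → IsSeamSystem b₀ r_S P S → IsQuantisedSeams b₁ S →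
    SmallStrain τ P X (volterraField P S β₀) → (∀ i, IsInvariantSet P (D i)) →
      -(ν₀ * springL ϱχ D σ (volterraField P S β₀) P X r₁ ϱ C) - η * nonAffL ϱχ D σ (volterraField P S β₀) P X r₁ ϱ C -
            c_T * shellMassL ϱχ D σ P X ϱ C - cχ * transMassL ϱχ D σ P X ϱ C -
          c_H * (pricedNearCountL ϱχ D σ P X ϱ C : ℝ) ≤
        geoL ϱχ D σ (volterraField P S β₀) P X ϱ C

/-- ★ piece [STIFF-q](`κ_B`) · [STIFF-ᶜ] VERBATIM over the quantised block · WEAKER than [STIFF-ᶜ] ⟸ [NN-ᶜ] (field-free, landed) · CERT · DECIDABLE ·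
ATTACKABLE-S.  Why it might fail: only through [NN-ᶜ] (a stress-free class image with nearest-neighbour distance `> 0.97198`). -/
def NearStiffQ (κ_B : ℝ) : Prop :=
  ∀ (P : PeriodicConfiguration 3) (C X : Set E3) (β₀ : E3 → E3 → E3) (k : ℕ) (S : Fin k → CutPiece)
    (m : ℕ) (D : Fin m → Set E3) (σ : Fin m → Bool),
    IsSeparatedRef s P → IsLabelledRef lam ℓ P → cls P.points → IsForceFree P → IsSiteStressFree P → HarmStableModRot μ₀ P →
    IsInvariantSet P C → IsInvariantSet P X → IsGlobalCocycle P β₀ → IsSeamSystem b₀ r_S P S → IsQuantisedSeams b₁ S →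
    SmallStrain τ P X (volterraField P S β₀) → (∀ i, IsInvariantSet P (D i)) →
      κ_B * springL ϱχ D σ (volterraField P S β₀) P X r₁ ϱ C ≤ barNearL ϱχ D σ r₁ (volterraField P S β₀) P X ϱ C

/-- ★ piece [MID-q](`κ₂, η₂, c_T, cχ`) · [MID-ᶜ] VERBATIM over the quantised block · WEAKER than [MID-ᶜ] · CERT at constant weight off the excision — NOW
HONESTLY: by `volterraField_localExact` every non-excised octahedron carries a coboundary, so part B's `octahedron_certificate` of NODE 71 applies to it
(sharp constant `|c₂| ≈ 0.466 < κ₂ = 1/2`) · ATTACKABLE-S · INSTRUMENTABLE.  Why it might fail: weight transport at the profile onset `δ′ ∈ [12, 16]`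
(deficit `≲ 5.8e-4·w` per site vs `c_T`); octahedra touching `X` (paid by `c_H`, crude). -/
def MidTrussQ (κ₂ η₂ c_T cχ : ℝ) : Prop :=
  ∃ c_H : ℝ, 0 ≤ c_H ∧ ∀ (P : PeriodicConfiguration 3) (C X : Set E3) (β₀ : E3 → E3 → E3) (k : ℕ) (S : Fin k → CutPiece)
    (m : ℕ) (D : Fin m → Set E3) (σ : Fin m → Bool),
    IsSeparatedRef s P → IsLabelledRef lam ℓ P → cls P.points → IsForceFree P → IsSiteStressFree P → HarmStableModRot μ₀ P →
    IsInvariantSet P C → IsInvariantSet P X → IsGlobalCocycle P β₀ → IsSeamSystem b₀ r_S P S → IsQuantisedSeams b₁ S →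
    SmallStrain τ P X (volterraField P S β₀) → (∀ i, IsInvariantSet P (D i)) →
      -(κ₂ * springL ϱχ D σ (volterraField P S β₀) P X r₁ ϱ C) + η₂ * nonAffL ϱχ D σ (volterraField P S β₀) P X r₁ ϱ C -
            c_T * shellMassL ϱχ D σ P X ϱ C - cχ * transMassL ϱχ D σ P X ϱ C -
          c_H * (pricedNearCountL ϱχ D σ P X ϱ C : ℝ) ≤
        barMidL ϱχ D σ r₁ r₂ (volterraField P S β₀) P X ϱ C

/-- ★ piece [FAR-q](`κ₃, η₃, c_T, cχ`) · [FAR-ᶜ] VERBATIM over the quantised block · WEAKER than [FAR-ᶜ] · UNDECIDED → TRUE-leaning (Bloch + affine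
requirement `0.443 | 0.400` vs `11/20 | 1/2`) · ATTACKABLE-M (isostatic cluster identities for shells 3–5 — applicable by local exactness, diameters
`< 10/3` — and Cauchy–Schwarz on the `8d⁻⁸` tail) · INSTRUMENTABLE.  Why it might fail: cluster constants within `24 %` of sharp jointly; onset
weight transport over longer clusters. -/
def FarTrussQ (κ₃ η₃ c_T cχ : ℝ) : Prop :=
  ∃ c_H : ℝ, 0 ≤ c_H ∧ ∀ (P : PeriodicConfiguration 3) (C X : Set E3) (β₀ : E3 → E3 → E3) (k : ℕ) (S : Fin k → CutPiece)
    (m : ℕ) (D : Fin m → Set E3) (σ : Fin m → Bool),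
    IsSeparatedRef s P → IsLabelledRef lam ℓ P → cls P.points → IsForceFree P → IsSiteStressFree P → HarmStableModRot μ₀ P →
    IsInvariantSet P C → IsInvariantSet P X → IsGlobalCocycle P β₀ → IsSeamSystem b₀ r_S P S → IsQuantisedSeams b₁ S →
    SmallStrain τ P X (volterraField P S β₀) → (∀ i, IsInvariantSet P (D i)) →
      -(κ₃ * springL ϱχ D σ (volterraField P S β₀) P X r₁ ϱ C) + η₃ * nonAffL ϱχ D σ (volterraField P S β₀) P X r₁ ϱ C -
            c_T * shellMassL ϱχ D σ P X ϱ C - cχ * transMassL ϱχ D σ P X ϱ C -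
          c_H * (pricedNearCountL ϱχ D σ P X ϱ C : ℝ) ≤
        barFarL ϱχ D σ r₂ (volterraField P S β₀) P X ϱ C

end Pieces

/-! ## §Q3 Every re-typed piece is implied by its record piece (PROVED: the binder is dropped) -/

section Weaker

variable {cls : Set E3 → Prop} {s lam ℓ μ₀ τ lamQ ϱ b₀ r_S ϱχ r₁ r₂ : ℝ} (b₁ : ℝ)

/-- (H𝄪ᶜ) ⟹ (H-q). -/
theorem LocalSeamTransferBoundCls.quantised {C_T Cχ : ℝ} (h : LocalSeamTransferBoundCls cls s lam ℓ μ₀ τ lamQ ϱ b₀ r_S C_T ϱχ Cχ) :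
    LocalSeamTransferBoundQ cls s lam ℓ μ₀ τ lamQ ϱ b₀ r_S b₁ ϱχ C_T Cχ := by
  obtain ⟨c, hc, h⟩ := h
  exact ⟨c, hc, fun P C X β₀ k S m D σ h1 h2 hb h3 h4 h5 h6 h7 h8 h9 _ h10 h11 => h P C X β₀ k S m D σ h1 h2 hb h3 h4 h5 h6 h7 h8 h9 h10 h11⟩

/-- [LOAD-ᶜ] ⟹ [LOAD-q]. -/
theorem LoadBoundCls.quantised {t A_T Aχ : ℝ} (h : LoadBoundCls cls s lam ℓ μ₀ τ ϱ b₀ r_S ϱχ r₁ t A_T Aχ) :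
    LoadBoundQ cls s lam ℓ μ₀ τ ϱ b₀ r_S b₁ ϱχ r₁ t A_T Aχ := by
  obtain ⟨c, hc, h⟩ := h
  exact ⟨c, hc, fun P C X β₀ k S m D σ h1 h2 hb h3 h4 h5 h6 h7 h8 h9 _ h10 h11 => h P C X β₀ k S m D σ h1 h2 hb h3 h4 h5 h6 h7 h8 h9 h10 h11⟩

/-- [COER-ᶜ] ⟹ [COER-q]. -/
theorem CoerciveStiffCls.quantised {μ c_T cχ : ℝ} (h : CoerciveStiffCls cls s lam ℓ μ₀ τ ϱ b₀ r_S ϱχ r₁ μ c_T cχ) :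
    CoerciveStiffQ cls s lam ℓ μ₀ τ ϱ b₀ r_S b₁ ϱχ r₁ μ c_T cχ := by
  obtain ⟨c, hc, h⟩ := h
  exact ⟨c, hc, fun P C X β₀ k S m D σ h1 h2 hb h3 h4 h5 h6 h7 h8 h9 _ h10 h11 => h P C X β₀ k S m D σ h1 h2 hb h3 h4 h5 h6 h7 h8 h9 h10 h11⟩

/-- [BAR♮-ᶜ] ⟹ [BAR♮-q]. -/
theorem BarExchCls.quantised {μ₁ η c_T cχ : ℝ} (h : BarExchCls cls s lam ℓ μ₀ τ ϱ b₀ r_S ϱχ r₁ μ₁ η c_T cχ) :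
    BarExchQ cls s lam ℓ μ₀ τ ϱ b₀ r_S b₁ ϱχ r₁ μ₁ η c_T cχ := by
  obtain ⟨c, hc, h⟩ := h
  exact ⟨c, hc, fun P C X β₀ k S m D σ h1 h2 hb h3 h4 h5 h6 h7 h8 h9 _ h10 h11 => h P C X β₀ k S m D σ h1 h2 hb h3 h4 h5 h6 h7 h8 h9 h10 h11⟩

/-- [GEO♮-ᶜ] ⟹ [GEO♮-q]. -/
theorem GeoExchCls.quantised {ν₀ η c_T cχ : ℝ} (h : GeoExchCls cls s lam ℓ μ₀ τ ϱ b₀ r_S ϱχ r₁ ν₀ η c_T cχ) :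
    GeoExchQ cls s lam ℓ μ₀ τ ϱ b₀ r_S b₁ ϱχ r₁ ν₀ η c_T cχ := by
  obtain ⟨c, hc, h⟩ := h
  exact ⟨c, hc, fun P C X β₀ k S m D σ h1 h2 hb h3 h4 h5 h6 h7 h8 h9 _ h10 h11 => h P C X β₀ k S m D σ h1 h2 hb h3 h4 h5 h6 h7 h8 h9 h10 h11⟩

/-- [STIFF-ᶜ] ⟹ [STIFF-q] … -/
theorem NearStiffCls.quantised {κ_B : ℝ} (h : NearStiffCls cls s lam ℓ μ₀ τ ϱ b₀ r_S ϱχ r₁ κ_B) :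
    NearStiffQ cls s lam ℓ μ₀ τ ϱ b₀ r_S b₁ ϱχ r₁ κ_B :=
  fun P C X β₀ k S m D σ h1 h2 hb h3 h4 h5 h6 h7 h8 h9 _ h10 h11 => h P C X β₀ k S m D σ h1 h2 hb h3 h4 h5 h6 h7 h8 h9 h10 h11

/-- … so the field-free [NN-ᶜ](`κ_B ≥ 0`) gives [STIFF-q] (NODE 71's `nearStiffCls_of_nnStiff`, by name). -/
theorem nearStiffQ_of_nnStiff {κ_B : ℝ} (hκ : 0 ≤ κ_B) (h : NnStiffCls cls κ_B r₁) : NearStiffQ cls s lam ℓ μ₀ τ ϱ b₀ r_S b₁ ϱχ r₁ κ_B :=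
  (nearStiffCls_of_nnStiff hκ h).quantised b₁

/-- [MID-ᶜ] ⟹ [MID-q]. -/
theorem MidTrussCls.quantised {κ₂ η₂ c_T cχ : ℝ} (h : MidTrussCls cls s lam ℓ μ₀ τ ϱ b₀ r_S ϱχ r₁ r₂ κ₂ η₂ c_T cχ) :
    MidTrussQ cls s lam ℓ μ₀ τ ϱ b₀ r_S b₁ ϱχ r₁ r₂ κ₂ η₂ c_T cχ := by
  obtain ⟨c, hc, h⟩ := h
  exact ⟨c, hc, fun P C X β₀ k S m D σ h1 h2 hb h3 h4 h5 h6 h7 h8 h9 _ h10 h11 => h P C X β₀ k S m D σ h1 h2 hb h3 h4 h5 h6 h7 h8 h9 h10 h11⟩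

/-- [FAR-ᶜ] ⟹ [FAR-q]. -/
theorem FarTrussCls.quantised {κ₃ η₃ c_T cχ : ℝ} (h : FarTrussCls cls s lam ℓ μ₀ τ ϱ b₀ r_S ϱχ r₁ r₂ κ₃ η₃ c_T cχ) :
    FarTrussQ cls s lam ℓ μ₀ τ ϱ b₀ r_S b₁ ϱχ r₁ r₂ κ₃ η₃ c_T cχ := by
  obtain ⟨c, hc, h⟩ := h
  exact ⟨c, hc, fun P C X β₀ k S m D σ h1 h2 hb h3 h4 h5 h6 h7 h8 h9 _ h10 h11 => h P C X β₀ k S m D σ h1 h2 hb h3 h4 h5 h6 h7 h8 h9 h10 h11⟩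

end Weaker

end Summit.AtomisticToContinuum.Crystallization.Theorems.ChargedEnergyGapChartDial
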